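import Summits.CriticalPhenomena.PercolationContinuityZ3.Theses.PercNearOneGluing
import Literature.Probability.Percolation.PercolationProofs
import Literature.Probability.Percolation.ConditionalPositiveAssociationProofs
import Literature.Probability.Percolation.TwoClusterConditionalAssociationProofs

/-! TTRL-lite variant V205 of stmt-CriticalPhenomena-4576

(`stub_goodStep`, move `small_case+small_case`: assume `A.card ≤ 2` and `n ≤ 2`).  The variant is
VACUOUS: the hypotheses `b ∈ A`, `o ∉ A` and `∃ y ∉ A, y ≠ o, w s(o, y) ≠ 0` produce three pairwise
distinct vertices `b, o, y : Fin n`, which is impossible when `n ≤ 2`.  No new definitions, no named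
facts; the strong-induction hypothesis and the `A.card ≤ 2` bound are not needed. -/

namespace Summit.CriticalPhenomena.PercolationContinuityZ3.Theorems

open MeasureTheory Literature.Probability.LatticeModels Literature.Probability.Percolation
open scoped Classical BigOperators

/-- TTRL-lite variant V205 of `stub_goodStep` (stmt-CriticalPhenomena-4576), the `n ≤ 2`,
`A.card ≤ 2` small case of the additive gluing good step.  It holds vacuously: `b ∈ A` and `o ∉ A`
give `b ≠ o`, the witness `y ∉ A` with `y ≠ o` gives a third vertex distinct from both, and three
pairwise distinct elements of `Fin n` contradict `n ≤ 2` (pigeonhole on the values, `omega`). -/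
theorem stub_goodStep_var205 : ∀ (n : ℕ) (w : Sym2 (Fin n) → unitInterval) (A : Finset (Fin n)) (o b : Fin n), n ≤ 2 → A.card ≤ 2 → b ∈ A → o ∉ A → (∃ y : Fin n, y ∉ A ∧ y ≠ o ∧ (w s(o, y) : ℝ) ≠ 0) → (∀ w' : Sym2 (Fin n) → unitInterval, (Finset.univ.filter (fun v : Fin n => ∃ u : Fin n, 0 < (w' s(u, v) : ℝ))).card < (Finset.univ.filter (fun v : Fin n => ∃ u : Fin n, 0 < (w s(u, v) : ℝ))).card → ∀ (A' : Finset (Fin n)) (o' b' : Fin n), b' ∈ A' → o' ∉ A' → ∀ (t : ℝ) (sel : Finset (Fin n) → Fin n), (∀ W, sel W ∈ A') → (∀ a ∈ A', 1 - t ≤ (prodBernoulli w').real (openConn a b')) → (prodBernoulli w').real ((⋃ a ∈ A', openConn o' a) ∩ (openConn o' b')ᶜ) + ∑ W ∈ (Finset.univ : Finset (Finset (Fin n))).filter (fun W => o' ∈ W ∧ Disjoint W A'), (prodBernoulli w').real {ω : BondConfig (Fin n) | openCluster ω o' = (W : Set (Fin n))} * (prodBernoulli w').real (openConnIn ((W :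 Set (Fin n))ᶜ) (sel W) b')ᶜ ≤ t) → ∀ (t : ℝ) (sel : Finset (Fin n) → Fin n), (∀ W, sel W ∈ A) → (∀ a ∈ A, 1 - t ≤ (prodBernoulli w).real (openConn a b)) → (prodBernoulli w).real ((⋃ a ∈ A, openConn o a) ∩ (openConn o b)ᶜ) + ∑ W ∈ (Finset.univ : Finset (Finset (Fin n))).filter (fun W => o ∈ W ∧ Disjoint W A), (prodBernoulli w).real {ω : BondConfig (Fin n) | openCluster ω o = (W : Set (Fin n))} * (prodBernoulli w).real (openConnIn ((W : Set (Fin n))ᶜ) (sel W) b)ᶜ ≤ t := by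
  intro n w A o b hn _ hb ho hy
  -- the three vertices `b`, `o`, `y` are pairwise distinct, contradicting `n ≤ 2`
  exfalso
  obtain ⟨y, hyA, hyo, -⟩ := hy
  have hbo : (b : ℕ) ≠ (o : ℕ) := fun h => ho (Fin.ext h ▸ hb)
  have hyo' : (y : ℕ) ≠ (o : ℕ) := fun h => hyo (Fin.ext h)
  have hyb : (y : ℕ) ≠ (b : ℕ) := fun h => hyA (Fin.ext h ▸ hb)
  have hb' : (b : ℕ) < n := b.isLt
  have ho' : (o : ℕ) < n := o.isLt
  have hy' : (y : ℕ) < n := y.isLt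
  omega

end Summit.CriticalPhenomena.PercolationContinuityZ3.Theorems
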